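/-
Width seat `ym-line-cbag-p1-w3` (prover-ym-line-cbag-p1-w3-g8-0), the only seat on LINE 3 `route-QuantumFields-SixPlaneColdBox`: the whole line
END TO END modulo its single open statement — the one-scale infrared stub of crux `TorusMeanNearColdBoxG` (stmt-QuantumFields-25708).
-/
import Summits.QuantumFields.YangMills.Theorems.SixPlaneColdBoxTorusMeanNearOfTopBox
import Summits.QuantumFields.YangMills.Theorems.SixPlaneColdBoxDensityTransferG
import Summits.QuantumFields.YangMills.Theorems.SixPlaneColdBoxAssembly

/-!
# LINE 3 `SixPlaneColdBox` modulo the top-box infrared stub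

Route `SixPlaneColdBox` (ideator cell ym-idea-2, LINE 3) onto the RECORD-type node `Theorems.LatticeNonFreezing`: items
25710 `Assembly` ✓ (`assembly_proof`, p1), 25709 `DensityTransferG` ✓ (`densityTransferG_proof`), 25708 `TorusMeanNearColdBoxG` (open; reduced to
its stub 1 by `torusMeanNearColdBoxG_of_topBox`), 25707 `BulkDominatesBoxDensityG` (target).  Composing the landed pieces:

* `bulkDominatesBoxDensityG_of_topBox` — the top-box infrared stub (ceiling `θ₁ ≤ 1/200`) implies the TARGET `BulkDominatesBoxDensityG`;
* `latticeNonFreezing_of_topBox` — and hence the node `LatticeNonFreezing`.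

So the line stands or falls with ONE statement: for every compact simple `G` and `r`, at one polynomial scale `⌈β^θ₁⌉` (`θ₁ ≤ 1/200`), for every
`0 < A < θ₁`, eventually in `β` and then in the torus size, `E_torus[c_q] − E_{cold box}[c_q(centre)] ≤ β^{−(1+4A+m)}` in every plane (its free
half `≥ −3β^{−5/4}` is `torusMean_sub_boxMean_ge`).  Conditional bookkeeping only; no sorry; standard axioms.  The Yang–Mills mass gap is NOT
proved by anything here, and the node `LatticeNonFreezing` is NOT proved here (RECORD-type).
-/

set_option autoImplicit false

noncomputable section

open MeasureTheory
open Literature.MathematicalPhysics.QuantumLattice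
open Literature.MathematicalPhysics.QuantumFieldTheory
open Summit.QuantumFields.YangMills.Theorems.WeakCouplingRates
open Summit.QuantumFields.YangMills.Theses.SixPlaneColdBox (TorusMeanNearColdBoxG BulkDominatesBoxDensityG)

namespace Summit.QuantumFields.YangMills.Theorems.SixPlaneColdBox

/-- **The target `BulkDominatesBoxDensityG` of route `SixPlaneColdBox` from the top-box infrared stub** (ceiling `θ₁ ≤ 1/200`):
`densityTransferG_proof ∘ torusMeanNearColdBoxG_of_topBox`. -/
theorem bulkDominatesBoxDensityG_of_topBox
    (h₁ : ∀ (G : Type) [Group G] [TopologicalSpace G] [IsTopologicalGroup G] [CompactSpace G],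
      IsCompactSimpleLieGroup G →
        letI : MeasurableSpace G := borel G
        haveI : BorelSpace G := ⟨rfl⟩
        ∀ r : LatticeRep G, ∃ θ₁ : ℝ, 0 < θ₁ ∧ θ₁ ≤ 1 / 200 ∧ ∀ A : ℝ, 0 < A → A < θ₁ → ∃ m : ℝ, 0 < m ∧
          ∃ β₀ : ℝ, ∀ β : ℝ, β₀ ≤ β → ∃ S₀ : ℕ, ∀ S : ℕ, S₀ ≤ S → ∀ i j : Fin 4, i < j →
            (∫ U, plaqCost0 r.ρ i j (torusLift (2 * S + 1) U) ∂(wilsonMeasure (d := 4) (L := 2 * S + 1) r.ρ β)) -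
                (∫ U, plaqCostAt r.ρ (boxCentre ⌈β ^ θ₁⌉₊) i j U ∂(boxState r.ρ β ⌈β ^ θ₁⌉₊)) ≤
              β ^ (-(1 + 4 * A + m))) :
    BulkDominatesBoxDensityG :=
  densityTransferG_proof (torusMeanNearColdBoxG_of_topBox h₁)

/-- **LINE 3 end to end modulo the top-box infrared stub**: the stub (ceiling `θ₁ ≤ 1/200`) implies the node `LatticeNonFreezing`
(`assembly_proof ∘ densityTransferG_proof ∘ torusMeanNearColdBoxG_of_topBox`).  The node is RECORD-type and is NOT proved here. -/
theorem latticeNonFreezing_of_topBox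
    (h₁ : ∀ (G : Type) [Group G] [TopologicalSpace G] [IsTopologicalGroup G] [CompactSpace G],
      IsCompactSimpleLieGroup G →
        letI : MeasurableSpace G := borel G
        haveI : BorelSpace G := ⟨rfl⟩
        ∀ r : LatticeRep G, ∃ θ₁ : ℝ, 0 < θ₁ ∧ θ₁ ≤ 1 / 200 ∧ ∀ A : ℝ, 0 < A → A < θ₁ → ∃ m : ℝ, 0 < m ∧
          ∃ β₀ : ℝ, ∀ β : ℝ, β₀ ≤ β → ∃ S₀ : ℕ, ∀ S : ℕ, S₀ ≤ S → ∀ i j : Fin 4, i < j →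
            (∫ U, plaqCost0 r.ρ i j (torusLift (2 * S + 1) U) ∂(wilsonMeasure (d := 4) (L := 2 * S + 1) r.ρ β)) -
                (∫ U, plaqCostAt r.ρ (boxCentre ⌈β ^ θ₁⌉₊) i j U ∂(boxState r.ρ β ⌈β ^ θ₁⌉₊)) ≤
              β ^ (-(1 + 4 * A + m))) :
    Summit.QuantumFields.YangMills.Theorems.LatticeNonFreezing :=
  assembly_proof (bulkDominatesBoxDensityG_of_topBox h₁)

end Summit.QuantumFields.YangMills.Theorems.SixPlaneColdBox

end
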